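import Literature.AlgebraicGeometry.Frobenioids.PerfectionModelFull
import Literature.AlgebraicGeometry.Frobenioids.PreFrobenioidDataToFunctor
import HarnessLib

/-!
# Frobenioids I, Prop. 5.5 (iv) for `C^pf`: the comparison functor is compatible with the functors to the
# elementary Frobenioid `F_{Φ^pf}` ON THE NOSE (proof-only companion)

Mochizuki, *The geometry of Frobenioids I: the general theory*, Kyushu J. Math. **62** (2008) 293–400,
Proposition 5.5 (iv) p. 104 l. 40–44: "there is a natural equivalence of categories [compatible with the
functors to the respective elementary Frobenioids] between `C^pf` … and the model Frobenioid associated to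
the data `Φ^pf, B^pf, B^pf → (Φ^gp)^pf`" [cite: MochizukiFrdI2008, Prop. 5.5 (iv) p.104].

abc-iut-L1-d9's chain (`PerfectionModelFunctor` p415505, `PerfectionModelEquivalence` p415941,
`PerfectionModelFull` p416228) builds the comparison functor
`PreFrobenioid.Perfection.ModelPf.toModelPf : C^pf ⥤ (model Frobenioid of Φ^pf, B^pf, Div_B^pf)`, proves it
is an equivalence, and records that it lies over the base category `D` on the nose (`toModelPfBaseIso`);
the slot `FrdI.Prop55Sub.Prop55iv_pf` (`Prop55Sub.lean`) it closes records the compatibility at the level of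
the base `D` only.  Print's bracket is the compatibility with the functors to the ELEMENTARY FROBENIOID
`F_{Φ^pf}` (Def. 1.1 (iii)/(iv): base, divisor monoid, `Div`, `deg_Fr`).  THIS FILE records that stronger,
printed form for the named functor, which holds DEFINITIONALLY: the pre-Frobenioid data
(`PreFrobenioidData.ofFunctor`, seat abc-iut-L1-t3's operations form of Def. 1.1 (iv)) of the composite
`C^pf → (model) → F_{Φ^pf}` (the model Frobenioid's structure functor `ModelFrobenioid.toElem`, Thm. 5.2 (i))
IS the pre-Frobenioid data `Perfection.ops hF` of `C^pf` (Prop. 3.2 (i), `PerfectionOps.lean`) — `Base`,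
`Φ^pf`, pull-backs, `Div`, `deg_Fr` all on the nose (`rfl`).  Found during the RQ7 second-pass audit of the
chain (abc-iut-w5-d049, HOME/staging/w5/w5-d049/AUDIT-p416228-PerfectionModelPf.md).  Proof-only: no new
definitions, no named facts; classical bookkeeping, nothing here bears on [IUTchIII] Cor. 3.12.
-/

namespace Literature.AlgebraicGeometry.Frobenioids

namespace PreFrobenioid

namespace Perfection

namespace ModelPf

open CategoryTheory Opposite

universe w v u

variable {D : Type u} [Category.{v} D] {Φ B : Dᵒᵖ ⥤ CommMonCat.{w}} {DivB : B ⟶ monoidGp Φ}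
  {hF : IsFrobenioid (ModelFrobenioid.toElem Φ B DivB)}
  (DivBpf : perfectionFunctor B ⟶ monoidGp (perfectionFunctor Φ))
  (hB : Objectwise (fun M _ => IsGroupLike M) B) (hDiv : IsPerfectedDiv Φ B DivB DivBpf)

/-- **Prop. 5.5 (iv), `C^pf`, "[compatible with the functors to the respective elementary Frobenioids]"**
(p. 104 l. 41), for the comparison functor `toModelPf`: the pre-Frobenioid data `(Base, Φ^pf, Div, deg_Fr)`
(Def. 1.1 (iv)) of the composite `C^pf → (model Frobenioid of Φ^pf, B^pf, Div_B^pf) → F_{Φ^pf}` IS the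
pre-Frobenioid data `Perfection.ops hF` of `C^pf` (Prop. 3.2 (i)) — on the nose.
[cite: MochizukiFrdI2008, Prop. 5.5 (iv) p.104] -/
theorem ofFunctor_toModelPf_comp_toElem :
    PreFrobenioidData.ofFunctor (perfectionFunctor Φ)
        (toModelPf hF DivBpf hB hDiv ⋙ ModelFrobenioid.toElem _ _ _) = ops hF :=
  rfl

/-- Equivalently (Def. 1.1 (iv) ⇄ functor form, `PreFrobenioidData.toFunctor`): the composite
`C^pf → (model) → F_{Φ^pf}` has the same operations as the functor `C^pf → F_{Φ^pf}` DETERMINED by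
`Perfection.ops hF`. [cite: MochizukiFrdI2008, Prop. 5.5 (iv) p.104] -/
theorem ofFunctor_toModelPf_comp_toElem_eq_ofFunctor_toFunctor :
    PreFrobenioidData.ofFunctor (perfectionFunctor Φ)
        (toModelPf hF DivBpf hB hDiv ⋙ ModelFrobenioid.toElem _ _ _) =
      PreFrobenioidData.ofFunctor (ops hF).monFunctor (ops hF).toFunctor := by
  rw [ofFunctor_toModelPf_comp_toElem, PreFrobenioidData.ofFunctor_toFunctor]

/-- Component form, `deg_Fr`: the Frobenius degree of the image arrow in `F_{Φ^pf}` is `deg_Fr` of `C^pf`.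
[cite: MochizukiFrdI2008, Prop. 5.5 (iv) p.104] -/
theorem degFr_toModelPf_comp_toElem {X Y : Perfection hF} (f : X ⟶ Y) :
    PreFrobenioid.degFr (toModelPf hF DivBpf hB hDiv ⋙ ModelFrobenioid.toElem _ _ _) f = (ops hF).degFr f :=
  rfl

/-- Component form, `Div`: the zero divisor of the image arrow in `F_{Φ^pf}` is `Div` of `C^pf` (in `Φ^pf`).
[cite: MochizukiFrdI2008, Prop. 5.5 (iv) p.104] -/
theorem div_toModelPf_comp_toElem {X Y : Perfection hF} (f : X ⟶ Y) :
    PreFrobenioid.Div (toModelPf hF DivBpf hB hDiv ⋙ ModelFrobenioid.toElem _ _ _) f = (ops hF).div f :=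
  rfl

/-- Component form, `Base` on arrows. [cite: MochizukiFrdI2008, Prop. 5.5 (iv) p.104] -/
theorem base_toModelPf_comp_toElem {X Y : Perfection hF} (f : X ⟶ Y) :
    PreFrobenioid.Base (toModelPf hF DivBpf hB hDiv ⋙ ModelFrobenioid.toElem _ _ _) f = (ops hF).base.map f :=
  rfl

/-- Component form, the base functor `C^pf → D` through `F_{Φ^pf} → D` is the base functor of `C^pf` (as
functors, on the nose; the base-level clause recorded by the slot `FrdI.Prop55Sub.Prop55iv_pf`).
[cite: MochizukiFrdI2008, Prop. 5.5 (iv) p.104] -/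
theorem baseFunctor_toModelPf_comp_toElem :
    PreFrobenioid.baseFunctor (toModelPf hF DivBpf hB hDiv ⋙ ModelFrobenioid.toElem _ _ _) = (ops hF).base :=
  rfl

end ModelPf

end Perfection

end PreFrobenioid

end Literature.AlgebraicGeometry.Frobenioids
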